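import Literature.IUT.HodgeTheaters.FPrimeStripsRealifiedSlot
import Literature.IUT.LogThetaLattice.BiCoresOfKitsWithRealifiedD
import Literature.IUT.LogThetaLattice.ThetaMonoidsOfKits
import Literature.IUT.LogThetaLattice.StripFrameOfKitsFullness
import Literature.IUT.HodgeTheaters.GlobalRealifiedFrobenioidsRigidity
import HarnessLib

/-!
# K4 RE-CLOSE of FACT-LIST row F-1998 `FKit.RlfOfIsStrip` at the kit with the SUPPLIED `ℱ^⊩` slot: [IUTchIII] Prop 1.2 (vi),
# Prop 2.1 (i), Thm 2.2 (i) (and Thm 1.5 (v)'s F-2066/F-2067 rows) over `StripFrame.ofKits` with `hR` DISCHARGED (PROOF-ONLY)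

Mochizuki, *Inter-universal Teichmüller Theory III*, kurims manuscript (May 2020) [paper:url-4b091feeb646]: Prop 1.2 (vi) p. 32, Thm 1.5
(v) pp. 50–51, Prop 2.1 (i) p. 58, Thm 2.2 (i) p. 65; *I* (May 2020) Rmk 5.2.1 (ii) p. 143 («`‡𝔉 ↦ ‡𝔉^⊩` … which forms an
`ℱ^⊩`-prime-strip … this follows immediately from the rigidity of the divisor monoids»).  Claim key `Mochizuki2012` DISPUTED (D-0012);
nothing of the series is asserted; no side is taken on [IUTchIII] Cor. 3.12.  abc-iut cell, seat abc-iut-w4-d009 (gen 9); plan C-R33 / K4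
(abc-iut-c312-2 `CONE-K4-RECLOSE.tsv` v4 rows IUTchIII:Prop1.2(vi) · Prop2.1(i) · Thm2.2(i), class RECLOSABLE, 0/1 INHABITED; NO-MATCH of
record abc-iut-L6-t5 g12 «no genuine ℱ-prime-strip kit ([IUTchI] Ex 3.5 constructions) in the tree»; abc-iut-w4-d014 g9's input
«RLF-SLOT@EX35-DIVISOR-MONOIDS»).  PROOF-ONLY: 0 definitions; every closer is abc-iut-L6-t3's / abc-iut-w4-d028's / abc-iut-w4-d005's
theorem APPLIED, nothing restated.

WHAT IS RE-CLOSED.  The three cone closers `BiCoricData.ofKits_mem_monoFxm_iff` (Prop 1.2 (vi)), `ThetaMonoidData.ofKits_ΨenvD_obj`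
(Prop 2.1 (i)), `StripFrame.ofKits_mapAut_surjective` (Thm 2.2 (i)) are stated over the real frame `StripFrame.ofKits L hbij hsurj hR X`
and bind `hR : FK.RlfOfIsStrip` — FACT-LIST F-1998, whose ∀-closure over all kits is REFUTED (`not_forall_rlfOfIsStrip`) and whose only
closed producers were toy kits and the datum form `rlfOfIsStrip_of_model`.  `FPrimeStripsRealifiedSlot.lean` SUPPLIES, for ANY kit `FK`,
the `ℱ^⊩` slot by the printed algorithm of [IUTchI] Rmk 5.2.1 (ii) / Ex 3.5 (i)(ii) at the divisor-monoid level (`FK.withRlfSlot c hc`,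
`c` = the positive scalars of the `ρ_v`) and PROVES `rlfOfIsStrip_withRlfSlot : (FK.withRlfSlot c hc).RlfOfIsStrip`.  Below, each closer
is re-derived over the frame `StripFrame.ofKits (L.withRlfSlot c hc) (isomFtoDBijective_withRlfSlot …) (isomFmtoDmSurjective_withRlfSlot …)
(rlfOfIsStrip_withRlfSlot …) X` — SAME `L`, `hbij`, `hsurj` over `FK` (transported; they do not involve the `ℱ^⊩` slot), `X`, `Bk`, `Tk`, `h`
VERBATIM as binders over the new kit, and `hR` REPLACED BY THE THEOREM.  Also: abc-iut-w4-d005's Thm 1.5 (v) closers for the companion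
`Bk.withRealifiedD line c' hc'` (c312-2 rows F-2066/F-2067, RECLOSED «modulo hR F-1998») with BOTH realified slots supplied — no `hR` left;
and the frame's `ℱ^⊩ ↦ ℱ^⊢` functor is the datum-(d) projection `(‡𝔉^⊢, c) ↦ ‡𝔉^⊢` ON THE NOSE.
HONEST SCOPE: re-closed-at-a-carrier ≠ proved-in-print; the `ℱ`/`ℱ^⊢`/`𝒟^⊢` slots, `X`, `Bk`, `Tk` stay inputs BY NAME (abc-iut-L5 / L6-t2
genuine kits); typed ≠ discharged; instantiated ≠ endorsed.
-/

noncomputable section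

namespace Literature.IUT.LogThetaLattice

open CategoryTheory
open Literature.IUT.HodgeTheaters Literature.IUT.HodgeTheaters.PMBaseKit Literature.IUT.HodgeArakelov
open Literature.AnabelianGeometry.AbsoluteAnabelian AsSmallTransport

universe u

variable {l : ℕ} {K : PMBaseKit.{u} l} {M : K.MultKit} {FK : K.FKit M}
variable (L : FK.MonoLaws) (hbij : FK.IsomFtoDBijective) (hsurj : FK.IsomFmtoDmSurjective)
  (c : K.V → ℝ) (hc : ∀ v, 0 < c v)
  (X : TimesMuSide (FK.withRlfSlot c hc) (L.withRlfSlot c hc))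

/-! ### 1. The real frame over the kit with the supplied `ℱ^⊩` slot: `hR` discharged -/

/-- **IUTchIII:Def1.1** (kurims p.23) the `ℱ^⊩ ↦ ℱ^⊢` functor of the real frame over `FK.withRlfSlot c hc` is, on objects, the datum-(d) PROJECTION
`(‡𝔉^⊢, c) ↦ ‡𝔉^⊢` ON THE NOSE ([IUTchI] Def 5.2 (iv) (d) «`‡𝔉^⊢ = {‡ℱ^⊢_v}_{v∈𝕍}` is an `ℱ^⊢`-prime-strip»). [cite: Mochizuki2012, Def 5.2 (iv) p.134] -/
theorem StripFrame.ofKits_withRlfSlot_fglToFv_obj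
    (A : (StripFrame.ofKits (L.withRlfSlot c hc) (FK.isomFtoDBijective_withRlfSlot c hc hbij)
      (FK.isomFmtoDmSurjective_withRlfSlot c hc hsurj) (FK.rlfOfIsStrip_withRlfSlot c hc) X).Fgl) (v : K.V) :
    (ULift.down ((StripFrame.ofKits (L.withRlfSlot c hc) (FK.isomFtoDBijective_withRlfSlot c hc hbij)
      (FK.isomFmtoDmSurjective_withRlfSlot c hc hsurj) (FK.rlfOfIsStrip_withRlfSlot c hc) X).FglToFv.obj A)).obj v =
      (ULift.down A).obj.fm v := rfl

/-- **IUTchIII:Thm2.2(i)** (kurims p.65 «the second arrows in each line are surjections») — abc-iut-w4-d028's closer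
`StripFrame.ofKits_mapAut_surjective` RE-CLOSED: the SAME statement over the real frame assembled from `FK.withRlfSlot c hc`, with the
F-1998 binder `hR` REPLACED by the theorem `rlfOfIsStrip_withRlfSlot`; `L`, `hbij`, `hsurj` over `FK`, `X`, `h` verbatim.
[cite: Mochizuki2012, Thm 2.2 (i) p.65] -/
theorem StripFrame.ofKits_withRlfSlot_mapAut_surjective
    (h : ∀ A B : X.Fglxm, Function.Surjective (fun g : A ≅ B => (X.FglxmToFvtxm ⋙ X.FvtxmToFxm).mapIso g))
    (A : (StripFrame.ofKits (L.withRlfSlot c hc) (FK.isomFtoDBijective_withRlfSlot c hc hbij)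
      (FK.isomFmtoDmSurjective_withRlfSlot c hc hsurj) (FK.rlfOfIsStrip_withRlfSlot c hc) X).Fglxm) :
    Function.Surjective ((StripFrame.ofKits (L.withRlfSlot c hc) (FK.isomFtoDBijective_withRlfSlot c hc hbij)
      (FK.isomFmtoDmSurjective_withRlfSlot c hc hsurj) (FK.rlfOfIsStrip_withRlfSlot c hc) X).FglxmToFxm.mapAut A) :=
  StripFrame.ofKits_mapAut_surjective _ _ _ _ X h A

/-- **IUTchIII:Prop2.1(i)** (kurims p.58) — abc-iut-L6-t3's closer `ThetaMonoidData.ofKits_ΨenvD_obj` RE-CLOSED over the real frame assembled from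
`FK.withRlfSlot c hc` (`hR := rlfOfIsStrip_withRlfSlot`; `Tk`, `h` verbatim): `Ψ_{env}(†𝔇_>)` of a `𝒟`-prime-strip of the frame IS the
kit-level one. [cite: Mochizuki2012, Prop 2.1 (i) p.58] -/
theorem ThetaMonoidData.ofKits_withRlfSlot_ΨenvD_obj
    (h : ∀ A B : X.Fglxm, Function.Surjective (fun g : A ≅ B => (X.FglxmToFvtxm ⋙ X.FvtxmToFxm).mapIso g))
    (Tk : ThetaMonoidKit X)
    (D : (StripFrame.ofKits (L.withRlfSlot c hc) (FK.isomFtoDBijective_withRlfSlot c hc hbij)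
      (FK.isomFmtoDmSurjective_withRlfSlot c hc hsurj) (FK.rlfOfIsStrip_withRlfSlot c hc) X).D) :
    (ThetaMonoidData.ofKits (L.withRlfSlot c hc) (FK.isomFtoDBijective_withRlfSlot c hc hbij)
      (FK.isomFmtoDmSurjective_withRlfSlot c hc hsurj) (FK.rlfOfIsStrip_withRlfSlot c hc) X h Tk).ΨenvD.obj D =
      AsSmall.up.obj (Tk.ΨenvD.obj (ULift.down D)) :=
  ThetaMonoidData.ofKits_ΨenvD_obj _ _ _ _ X h Tk D

/-- **IUTchIII:Prop2.1(ii)** (kurims p.58) hence abc-iut-L6-t3's interface `ThetaMonoidData` over the real frame assembled from `FK.withRlfSlot c hc`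
is INHABITED from kit-level theta-monoid data and the one hypothesis `h` on the Def 4.9 input — with NO `RlfOfIsStrip` hypothesis.
[cite: Mochizuki2012, Prop 2.1 (ii) p.58] -/
theorem nonempty_thetaMonoidData_ofKits_withRlfSlot
    (h : ∀ A B : X.Fglxm, Function.Surjective (fun g : A ≅ B => (X.FglxmToFvtxm ⋙ X.FvtxmToFxm).mapIso g))
    (hT : Nonempty (ThetaMonoidKit X)) :
    Nonempty (ThetaMonoidData (StripFrame.ofKits (L.withRlfSlot c hc) (FK.isomFtoDBijective_withRlfSlot c hc hbij)
      (FK.isomFmtoDmSurjective_withRlfSlot c hc hsurj) (FK.rlfOfIsStrip_withRlfSlot c hc) X)) :=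
  nonempty_thetaMonoidData_ofKits _ _ _ _ X h hT

/-- **IUTchIII:Prop1.2(vi)** (kurims p.32) — abc-iut-L6-t3's closer `BiCoricData.ofKits_mem_monoFxm_iff` RE-CLOSED over the real frame assembled
from `FK.withRlfSlot c hc` (`hR := rlfOfIsStrip_withRlfSlot`; `Bk` verbatim): membership in the `Ism`-orbit `log(†𝔇^⊢) ⥲ log(†𝔉^{⊢×μ})` is
kit-level membership. [cite: Mochizuki2012, Prop 1.2 (vi) p.32] -/
theorem BiCoricData.ofKits_withRlfSlot_mem_monoFxm_iff (Bk : BiCoricKit X)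
    (A : (StripFrame.ofKits (L.withRlfSlot c hc) (FK.isomFtoDBijective_withRlfSlot c hc hbij)
      (FK.isomFmtoDmSurjective_withRlfSlot c hc hsurj) (FK.rlfOfIsStrip_withRlfSlot c hc) X).Fxm)
    (e : (BiCoricData.ofKits (L.withRlfSlot c hc) (FK.isomFtoDBijective_withRlfSlot c hc hbij)
        (FK.isomFmtoDmSurjective_withRlfSlot c hc hsurj) (FK.rlfOfIsStrip_withRlfSlot c hc) X Bk).monoShell.obj
        ((StripFrame.ofKits (L.withRlfSlot c hc) (FK.isomFtoDBijective_withRlfSlot c hc hbij)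
          (FK.isomFmtoDmSurjective_withRlfSlot c hc hsurj) (FK.rlfOfIsStrip_withRlfSlot c hc) X).FxmToDv.obj A) ≅
      (BiCoricData.ofKits (L.withRlfSlot c hc) (FK.isomFtoDBijective_withRlfSlot c hc hbij)
        (FK.isomFmtoDmSurjective_withRlfSlot c hc hsurj) (FK.rlfOfIsStrip_withRlfSlot c hc) X Bk).fxmShell.obj A) :
    e ∈ (BiCoricData.ofKits (L.withRlfSlot c hc) (FK.isomFtoDBijective_withRlfSlot c hc hbij)
        (FK.isomFmtoDmSurjective_withRlfSlot c hc hsurj) (FK.rlfOfIsStrip_withRlfSlot c hc) X Bk).monoFxm A ↔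
      AsSmall.down.mapIso e ∈ Bk.monoFxm (ULift.down A) :=
  BiCoricData.ofKits_mem_monoFxm_iff _ _ _ _ X Bk A e

/-- **IUTchIII:Prop1.2(viii)** (kurims p.33) hence abc-iut-L6-t3's interface `BiCoricData` over the real frame assembled from `FK.withRlfSlot c hc` is
INHABITED from kit-level bi-coric data — with NO `RlfOfIsStrip` hypothesis. [cite: Mochizuki2012, Prop 1.2 (viii) p.33] -/
theorem nonempty_biCoricData_ofKits_withRlfSlot (hB : Nonempty (BiCoricKit X)) :
    Nonempty (BiCoricData (StripFrame.ofKits (L.withRlfSlot c hc) (FK.isomFtoDBijective_withRlfSlot c hc hbij)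
      (FK.isomFmtoDmSurjective_withRlfSlot c hc hsurj) (FK.rlfOfIsStrip_withRlfSlot c hc) X)) :=
  nonempty_biCoricData_ofKits _ _ _ _ X hB

/-! ### 2. Thm 1.5 (v) with BOTH realified slots supplied: `ℱ^⊩` (this seat, gen 9) and `D^⊩` (abc-iut-w4-d005 over this seat's `realifiedD`) -/

section BothSlots

variable (Bk : BiCoricKit X) (line : M.DMono → K.V → RLine.{u}) (c' : K.V → ℝ) (hc' : ∀ v, 0 < c' v)

/-- **IUTchIII:Thm1.5(v)** (kurims p.50 «induce … AN isomorphism of collections of data») — `Thm15vSingleIso` (FACT-LIST F-2067's shape) for the real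
frame assembled from `FK.withRlfSlot c hc` and the companion `Bk.withRealifiedD line c' hc'`: abc-iut-w4-d005's
`thm15vSingleIso_ofKits_withRealifiedD` with the F-1998 binder REPLACED by `rlfOfIsStrip_withRlfSlot` — NO hypothesis on either realified slot.
[cite: Mochizuki2012, Thm 1.5 (v) p.50] -/
theorem thm15vSingleIso_ofKits_withRlfSlot_withRealifiedD :
    (BiCoricData.ofKits (L.withRlfSlot c hc) (FK.isomFtoDBijective_withRlfSlot c hc hbij)
      (FK.isomFmtoDmSurjective_withRlfSlot c hc hsurj) (FK.rlfOfIsStrip_withRlfSlot c hc) X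
      (Bk.withRealifiedD line c' hc')).Thm15vSingleIso :=
  thm15vSingleIso_ofKits_withRealifiedD _ _ _ _ X Bk line c' hc'

/-- **IUTchII:Cor4.10(v)** (kurims p.160) — `RealifiedRigidAt` (FACT-LIST F-2066's shape) at every pair of `𝒟^⊢`-prime-strips of the real frame
assembled from `FK.withRlfSlot c hc`, for the companion `Bk.withRealifiedD line c' hc'`: abc-iut-w4-d005's `realifiedRigidAt_ofKits_withRealifiedD`
with the F-1998 binder REPLACED by `rlfOfIsStrip_withRlfSlot` (c312-2 v4 row F-2066 «RECLOSED … modulo hR F-1998»: the modulo is GONE).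
[cite: Mochizuki2012, Cor 4.10 (v) p.160] -/
theorem realifiedRigidAt_ofKits_withRlfSlot_withRealifiedD
    (A B : (StripFrame.ofKits (L.withRlfSlot c hc) (FK.isomFtoDBijective_withRlfSlot c hc hbij)
      (FK.isomFmtoDmSurjective_withRlfSlot c hc hsurj) (FK.rlfOfIsStrip_withRlfSlot c hc) X).Dv) :
    (BiCoricData.ofKits (L.withRlfSlot c hc) (FK.isomFtoDBijective_withRlfSlot c hc hbij)
      (FK.isomFmtoDmSurjective_withRlfSlot c hc hsurj) (FK.rlfOfIsStrip_withRlfSlot c hc) X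
      (Bk.withRealifiedD line c' hc')).RealifiedRigidAt A B :=
  realifiedRigidAt_ofKits_withRealifiedD _ _ _ _ X Bk line c' hc' A B

end BothSlots

/-! ### 3. The scalars OF RECORD: `c_v := [K_v̲:(F_mod)_v]⁻¹` of [IUTchI] Ex 3.5 (i) over REAL initial Θ-data (abc-iut-L5-t2 `rhoScalar`) -/

section GenuineScalars

variable {F₀ : Type} {K₀ : Type} {Fbar : Type} [Field F₀] [NumberField F₀] [Field K₀] [NumberField K₀] [Algebra F₀ K₀]
  [Field Fbar] [Algebra F₀ Fbar] [Algebra K₀ Fbar] {E : WeierstrassCurve F₀} [E.IsElliptic] {P : BadPlacePredicates K₀}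
  (D : InitialThetaData F₀ K₀ Fbar E l P) (pl : K.V → Val K₀)

/-- **IUTchI:Ex3.5(i)** (kurims p.84 «`log^⊢_mod(p_v) ↦ (1/[K_v:(F_mod)_v]) log_Φ(p_v)`») — Rmk 5.2.1 (ii)'s `RlfOfIsStrip` for the `ℱ^⊩` slot supplied
with THE PRINTED SCALARS of the `ρ_v` over REAL initial Θ-data `D` (abc-iut-L5-t2's `InitialThetaData.rhoScalar`, positive by this seat's
gen-0 `rhoScalar_pos`), for any kit `FK` whose index set `𝕍` is read in `𝕍(K)` by `pl` (abc-iut-L5-t4's `PlaceKit`: `𝕍 = V̲`): NO hypothesis.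
[cite: Mochizuki2012, Ex 3.5 (i) p.84] -/
theorem rlfOfIsStrip_withRlfSlot_rhoScalar :
    (FK.withRlfSlot (fun v => (D.rhoScalar (pl v) : ℝ)) (fun v => NNReal.coe_pos.mpr (D.rhoScalar_pos (pl v)))).RlfOfIsStrip :=
  FK.rlfOfIsStrip_withRlfSlot _ _

end GenuineScalars

end Literature.IUT.LogThetaLattice
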